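import Literature.Geometry.Lorentzian.KerrTortoiseRadius
import HarnessLib

/-!
# Tortoise radius functions are onto `(r₊, ∞)`; limits along `r* → ∓∞`

(namespace `Literature.Geometry.Lorentzian.Kerr`, dot-notation API on `Kerr.IsTortoiseRadius`;
a small utility file on top of `KerrTortoiseRadius.lean`.)

A tortoise radius function `ρ` of `g_{M,a}` (`Kerr.IsTortoiseRadius M a ρ`:
`dρ/dx = Δ(ρ)/(ρ² + a²)`, `ρ > r₊`, `ρ → r₊` at `−∞`, `ρ → ∞` at `+∞`) is the radius `r` read
along the tortoise coordinate `x = r* + const`; Dafermos–Rodnianski–Shlapentokh-Rothman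
(arXiv:1402.7034, §2.1.2) note that "the coordinate range `r > r₊` corresponds to the range
`r* > −∞`". This file records the two facts every passage between `r`-statements and
`r*`-statements uses:

* **surjectivity** — every `r > r₊` is `ρ x` for some `x` (`IsTortoiseRadius.exists_apply_eq`,
  intermediate value theorem; `range_eq : range ρ = Ioi r₊`, `surjOn`), uniquely so for
  `|a| < M` (`existsUnique_eq`, `injective`, `le_iff_le`, `lt_iff_lt`, from `strictMono`);
* **end filters** — `ρ → r₊⁺` as `x → −∞` *within* `(r₊, ∞)` (`tendsto_nhdsGT :
  Tendsto ρ atBot (𝓝[>] r₊)`), so one-sided `r`-limits at `r₊` compose with `x → −∞`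
  (`tendsto_comp_atBot`, `tendsto_comp_atTop`); for `|a| < M` in fact `map ρ atBot = 𝓝[>] r₊`,
  `map ρ atTop = atTop` (`map_atBot`, `map_atTop`, `tendsto_comp_atBot_iff`,
  `tendsto_comp_atTop_iff`).

(`IsTortoiseRadius.exists_eq` is the same surjectivity with a redundant `|a| < M` hypothesis,
`KerrTrappingMultipliers.lean`; the hypothesis-free version here is `exists_apply_eq`.)

## References

* M. Dafermos, I. Rodnianski, Y. Shlapentokh-Rothman, *Decay for solutions of the wave equation on
  Kerr exterior spacetimes III*, arXiv:1402.7034 = Ann. of Math. 183 (2016), §2.1.2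
  (key `DafermosRodnianskiShlapentokhrothman2014`).
-/

noncomputable section

open Filter Set
open scoped _root_.Topology

namespace Literature.Geometry.Lorentzian

namespace Kerr

namespace IsTortoiseRadius

variable {M a : ℝ} {ρ : ℝ → ℝ}

/-! ### Surjectivity onto `(r₊, ∞)` -/

/-- **Every `r > r₊` is a value of a tortoise radius function** (`ρ` is continuous, `→ r₊` at
`−∞`, `→ ∞` at `+∞`: intermediate value theorem). DRSR arXiv:1402.7034, §2.1.2: "the coordinate
range `r > r₊` corresponds to the range `r* > −∞`".
[cite: DafermosRodnianskiShlapentokhrothman2014, §2.1.2] -/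
theorem exists_apply_eq (hρ : IsTortoiseRadius M a ρ) {r : ℝ} (hr : rPlus M a < r) :
    ∃ x, ρ x = r := by
  obtain ⟨x₁, hx₁⟩ := (hρ.tendsto_atBot.eventually_lt_const hr).exists
  obtain ⟨x₂, hx₂⟩ := (hρ.tendsto_atTop.eventually (eventually_ge_atTop r)).exists
  exact mem_range_of_exists_le_of_exists_ge hρ.continuous ⟨x₁, hx₁.le⟩ ⟨x₂, hx₂⟩

/-- The range of a tortoise radius function is exactly `(r₊, ∞)`. [folklore] -/
theorem range_eq (hρ : IsTortoiseRadius M a ρ) : range ρ = Ioi (rPlus M a) :=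
  Subset.antisymm (range_subset_iff.2 hρ.rPlus_lt) fun _ hr ↦ hρ.exists_apply_eq hr

/-- A tortoise radius function maps `ℝ` onto `(r₊, ∞)`. [folklore] -/
theorem surjOn (hρ : IsTortoiseRadius M a ρ) : SurjOn ρ univ (Ioi (rPlus M a)) := by
  rw [SurjOn, image_univ, hρ.range_eq]

/-- Eventually (as `x → −∞`) `ρ < r`, for any `r > r₊`. [folklore] -/
theorem eventually_lt (hρ : IsTortoiseRadius M a ρ) {r : ℝ} (hr : rPlus M a < r) :
    ∀ᶠ x in atBot, ρ x < r :=
  hρ.tendsto_atBot.eventually_lt_const hr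

/-! ### Injectivity and unique preimages (`|a| < M`) -/

/-- A tortoise radius function is injective (`|a| < M`). [folklore] -/
theorem injective (hρ : IsTortoiseRadius M a ρ) (hMa : IsSubextremal M a) :
    Function.Injective ρ :=
  (hρ.strictMono hMa).injective

/-- `ρ x ≤ ρ y ↔ x ≤ y` (`|a| < M`). [folklore] -/
theorem le_iff_le (hρ : IsTortoiseRadius M a ρ) (hMa : IsSubextremal M a) {x y : ℝ} :
    ρ x ≤ ρ y ↔ x ≤ y :=
  (hρ.strictMono hMa).le_iff_le

/-- `ρ x < ρ y ↔ x < y` (`|a| < M`). [folklore] -/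
theorem lt_iff_lt (hρ : IsTortoiseRadius M a ρ) (hMa : IsSubextremal M a) {x y : ℝ} :
    ρ x < ρ y ↔ x < y :=
  (hρ.strictMono hMa).lt_iff_lt

/-- **Every `r > r₊` is `ρ x` for a unique `x`** (`|a| < M`): `ρ` is a bijection `ℝ → (r₊, ∞)`,
i.e. `r` is an invertible function of `r*`.
[cite: DafermosRodnianskiShlapentokhrothman2014, §2.1.2] -/
theorem existsUnique_eq (hρ : IsTortoiseRadius M a ρ) (hMa : IsSubextremal M a) {r : ℝ}
    (hr : rPlus M a < r) : ∃! x, ρ x = r := by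
  obtain ⟨x, rfl⟩ := hρ.exists_apply_eq hr
  exact ⟨x, rfl, fun y hy ↦ hρ.injective hMa hy⟩

/-! ### End filters: `x → −∞` is `r → r₊⁺`, `x → +∞` is `r → ∞` -/

/-- **Along a tortoise radius function, `x → −∞` is `r → r₊⁺`**: `ρ → r₊` at `−∞` with `ρ > r₊`,
i.e. `ρ` tends to `r₊` within `(r₊, ∞)`. [cite: DafermosRodnianskiShlapentokhrothman2014, §2.1.2] -/
theorem tendsto_nhdsGT (hρ : IsTortoiseRadius M a ρ) : Tendsto ρ atBot (𝓝[>] (rPlus M a)) :=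
  tendsto_nhdsWithin_iff.2 ⟨hρ.tendsto_atBot, Eventually.of_forall hρ.rPlus_lt⟩

/-- One-sided limits at `r₊` compose with `x → −∞`: if `f → l` as `r → r₊⁺` then `f ∘ ρ → l` as
`x → −∞`. [folklore] -/
theorem tendsto_comp_atBot {α : Type*} {l : Filter α} {f : ℝ → α} (hρ : IsTortoiseRadius M a ρ)
    (hf : Tendsto f (𝓝[>] (rPlus M a)) l) : Tendsto (f ∘ ρ) atBot l :=
  hf.comp hρ.tendsto_nhdsGT

/-- Limits at `r → ∞` compose with `x → +∞`: if `f → l` as `r → ∞` then `f ∘ ρ → l` as `x → +∞`.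
[folklore] -/
theorem tendsto_comp_atTop {α : Type*} {l : Filter α} {f : ℝ → α} (hρ : IsTortoiseRadius M a ρ)
    (hf : Tendsto f atTop l) : Tendsto (f ∘ ρ) atTop l :=
  hf.comp hρ.tendsto_atTop

/-- **`ρ` pushes `x → −∞` forward to exactly `r → r₊⁺`**: `map ρ atBot = 𝓝[>] r₊` (`|a| < M`;
`ρ` is an increasing homeomorphism `ℝ → (r₊, ∞)`). [folklore] -/
theorem map_atBot (hρ : IsTortoiseRadius M a ρ) (hMa : IsSubextremal M a) :
    map ρ atBot = 𝓝[>] (rPlus M a) := by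
  refine le_antisymm hρ.tendsto_nhdsGT (le_def.2 fun s hs ↦ ?_)
  have hs' : ρ ⁻¹' s ∈ atBot := hs
  obtain ⟨x₀, hx₀⟩ := mem_atBot_sets.1 hs'
  refine mem_of_superset (Ioc_mem_nhdsGT (hρ.rPlus_lt x₀)) fun r hr ↦ ?_
  obtain ⟨x, rfl⟩ := hρ.exists_apply_eq hr.1
  exact hx₀ x ((hρ.le_iff_le hMa).1 hr.2)

/-- **`ρ` pushes `x → +∞` forward to exactly `r → ∞`**: `map ρ atTop = atTop` (`|a| < M`).
[folklore] -/
theorem map_atTop (hρ : IsTortoiseRadius M a ρ) (hMa : IsSubextremal M a) :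
    map ρ atTop = atTop := by
  refine le_antisymm hρ.tendsto_atTop (le_def.2 fun s hs ↦ ?_)
  have hs' : ρ ⁻¹' s ∈ atTop := hs
  obtain ⟨x₀, hx₀⟩ := mem_atTop_sets.1 hs'
  refine mem_of_superset (Ici_mem_atTop (ρ x₀)) fun r hr ↦ ?_
  obtain ⟨x, rfl⟩ := hρ.exists_apply_eq ((hρ.rPlus_lt x₀).trans_le hr)
  exact hx₀ x ((hρ.le_iff_le hMa).1 hr)

/-- `f ∘ ρ → l` as `x → −∞` **iff** `f → l` as `r → r₊⁺` (`|a| < M`): limits at the horizon end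
may be computed in either variable. [folklore] -/
theorem tendsto_comp_atBot_iff {α : Type*} {l : Filter α} {f : ℝ → α}
    (hρ : IsTortoiseRadius M a ρ) (hMa : IsSubextremal M a) :
    Tendsto (f ∘ ρ) atBot l ↔ Tendsto f (𝓝[>] (rPlus M a)) l := by
  rw [← tendsto_map'_iff, hρ.map_atBot hMa]

/-- `f ∘ ρ → l` as `x → +∞` **iff** `f → l` as `r → ∞` (`|a| < M`). [folklore] -/
theorem tendsto_comp_atTop_iff {α : Type*} {l : Filter α} {f : ℝ → α}
    (hρ : IsTortoiseRadius M a ρ) (hMa : IsSubextremal M a) :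
    Tendsto (f ∘ ρ) atTop l ↔ Tendsto f atTop l := by
  rw [← tendsto_map'_iff, hρ.map_atTop hMa]

end IsTortoiseRadius

end Kerr

end Literature.Geometry.Lorentzian

end
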